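import Summits.AnomalousDissipation.AnomalousDissipation.Theorems.BaireTransferRobustLoudUpgradeStubSmallFlowNondeg

/-!
# Line `malkin-cone-group-orbits` (crux stmt-AnomalousDissipation-1144, companion c2): the INHOMOGENEOUS classical-to-lattice
# dictionary for the linearised steady Navier–Stokes operator

Helper layer (pure proof file).  The steady Fourier lattice of `Literature/Analysis/FluidPDE/SteadyNSLatticePersistence.lean`
provides the lattice-to-classical direction for the linearised resolvent relation
(`SteadyLattice.exists_linNSResolventRel_of_latticeEq`: a square-summable solution of
`ν4π²|k|² ŵ(k) + Π_k (N(Û,ŵ) + N(ŵ,Û))(k) = −Π_k ĝ(k)` is a classical solution of `L(ν,U) w = g`), and the tree has the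
classical-to-lattice direction for the HOMOGENEOUS equation (`SmallFlowNondeg.leray_linearised_eq`, resting on
`KolmogorovShear.fourier_eq_of_linearizedNSOperator_eq_zero`).  This file supplies the classical-to-lattice direction
WITH A RIGHT-HAND SIDE, needed to read classical solvability hypotheses (`∃ w, LinNSResolventRel ν U 0 w g`) as range
statements `T x = −ê_g` for the lattice linearisation `T`:

* `fourier_eq_of_linearizedNSOperator_eq_rhs` — componentwise Fourier identity for `L(ν,U)(w,q) = G`;
* `leray_linearised_eq_rhs` — its Leray-projected form `ν4π²|k|² ŵ(k) + Π_k (N(Û,ŵ) + N(ŵ,Û))(k) = −Π_k Ĝ(k)`;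
* `latticeEq_of_linNSResolventRel` — the same read off `Torus.LinNSResolventRel ν U 0 w G`.

References: Temam 1979 Ch. II §1; Constantin–Foias 1988 Ch. 7 (the linearisation); pattern of `KolmogorovShearLinearised`.
-/

-- `Summit.<Summit>.<Problem>` is the tree's mandated summit-side namespace (CONVENTIONS §2); for this
-- single-conjunct summit the two coincide, so the duplicate is deliberate.
set_option linter.dupNamespace false

noncomputable section

open scoped BigOperators Topology ENNReal NNReal InnerProductSpace ComplexConjugate
open Filter Set Function TopologicalSpace MeasureTheory UnitAddTorus Complex

namespace Summit.AnomalousDissipation.AnomalousDissipation.Theorems.RobustLoudUpgrade.LsTransfer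

open Literature.Analysis.FunctionSpaces Literature.Analysis.FunctionSpaces.Torus
open Literature.Analysis.FunctionSpaces.EuclideanSpace
open Literature.Analysis.FluidPDE
open Literature.Analysis.FluidPDE.ScalarFourier
open Literature.Analysis.FluidPDE.SteadyLattice

/-- **The linearised equation with a right-hand side in Fourier variables, componentwise**: if
`L(ν,U)(w,q) = G` classically then `−ν4π²|k|² ŵ(k)_p − (N(Û,ŵ)(k)_p + N(ŵ,Û)(k)_p) − 2πi q̂(k) k_p = Ĝ(k)_p`
(pattern of `KolmogorovShear.fourier_eq_of_linearizedNSOperator_eq_zero`). [folklore] -/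
theorem fourier_eq_of_linearizedNSOperator_eq_rhs {ν : ℝ} {U : UnitAddTorus (Fin 3) → EuclideanSpace ℝ (Fin 3)}
    (hU : IsSmooth U) {w G : UnitAddTorus (Fin 3) → EuclideanSpace ℂ (Fin 3)} {q : UnitAddTorus (Fin 3) → ℂ}
    (hw : IsSmooth w) (hq : IsSmooth q)
    (hE : ∀ x, Torus.linearizedNSOperator ν U w q x = G x) (k : Fin 3 → ℤ) (p : Fin 3) :
    -((ν * (4 * Real.pi ^ 2 * freqNormSq k) : ℝ) : ℂ) * mFourierCoeff w k p -
      (transportSym (fun j m => mFourierCoeff (complexify ∘ U) m j) (fun m => mFourierCoeff w m p) k +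
        transportSym (fun j m => mFourierCoeff w m j) (fun m => mFourierCoeff (complexify ∘ U) m p) k) -
      2 * Real.pi * I * mFourierCoeff q k * (k p : ℂ) = mFourierCoeff G k p := by
  have i1 : Integrable (fun y => laplacian w y) volume := hw.laplacian.integrable
  have i1' : Integrable ((ν : ℂ) • fun y => laplacian w y) volume := i1.smul (ν : ℂ)
  have i2 : Integrable (Torus.convect U w) volume := (hU.convect hw).integrable
  have i3 : Integrable (Torus.stretch w U) volume := (isSmooth_stretch hU hw).integrable
  have i4 : Integrable (Torus.gradientC q) volume := by
    refine Continuous.integrable_unitAddTorus ?_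
    exact (PiLp.continuous_toLp 2 _).comp (continuous_pi fun l => (hq.partialDeriv l).continuous)
  have hfun : (fun y => Torus.linearizedNSOperator ν U w q y) =
      ((ν : ℂ) • fun y => laplacian w y) - (Torus.convect U w + Torus.stretch w U) - Torus.gradientC q := by
    funext y
    simp only [Torus.linearizedNSOperator_apply, Pi.sub_apply, Pi.add_apply, Pi.smul_apply, Complex.coe_smul]
  have hGfun : (fun y => Torus.linearizedNSOperator ν U w q y) = G := funext hE
  have hk : mFourierCoeff (fun y => Torus.linearizedNSOperator ν U w q y) k = mFourierCoeff G k := by rw [hGfun]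
  rw [hfun, mFourierCoeff_sub (i1'.sub (i2.add i3)) i4, mFourierCoeff_sub i1' (i2.add i3), mFourierCoeff_add i2 i3,
    mFourierCoeff_const_smul, mFourierCoeff_convect_complex hU hw k, mFourierCoeff_stretch hU hw k,
    mFourierCoeff_gradientC hq k, show (fun y => laplacian w y) = laplacian w from rfl,
    Torus.mFourierCoeff_laplacian hw k] at hk
  have h := congrArg (fun v : EuclideanSpace ℂ (Fin 3) => v p) hk
  simp only [PiLp.sub_apply, PiLp.add_apply, PiLp.smul_apply, PiLp.neg_apply, smul_eq_mul,
    Torus.freqVec_apply] at h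
  rw [← h]
  push_cast
  ring

/-- **Leray-projected lattice form of `L(ν,U)(w,q) = G`** for a divergence-free mean-zero `w`:
`ν4π²|k|² ŵ(k) + Π_k (N(Û,ŵ) + N(ŵ,Û))(k) = −Π_k Ĝ(k)` (the Leray symbol kills the pressure gradient and fixes the
transversal `ŵ(k)`; pattern of `SmallFlowNondeg.leray_linearised_eq`). [folklore] -/
theorem leray_linearised_eq_rhs {ν : ℝ} {U : UnitAddTorus (Fin 3) → EuclideanSpace ℝ (Fin 3)} (hU : IsSmooth U)
    {w G : UnitAddTorus (Fin 3) → EuclideanSpace ℂ (Fin 3)} {q : UnitAddTorus (Fin 3) → ℂ} (hw : IsSmooth w)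
    (hdiv : Torus.IsDivFreeC w) (h0 : HasZeroMean w) (hq : IsSmooth q)
    (hE : ∀ x, Torus.linearizedNSOperator ν U w q x = G x) (k : Fin 3 → ℤ) :
    (((ν * (4 * Real.pi ^ 2 * freqNormSq k)) : ℝ) : ℂ) • mFourierCoeff w k +
      Torus.lerayCoeff k
        ((WithLp.toLp 2 (fun pp : Fin 3 => transportSym (fun jj mm => mFourierCoeff (complexify ∘ U) mm jj)
            (fun mm => mFourierCoeff w mm pp) k) : EuclideanSpace ℂ (Fin 3)) +
          (WithLp.toLp 2 (fun pp : Fin 3 => transportSym (fun jj mm => mFourierCoeff w mm jj)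
            (fun mm => mFourierCoeff (complexify ∘ U) mm pp) k) : EuclideanSpace ℂ (Fin 3))) =
      -Torus.lerayCoeff k (mFourierCoeff G k) := by
  -- the unprojected identity `ν4π²|k|² ŵ + N(Û,ŵ) + N(ŵ,Û) + (2πi q̂) k = −Ĝ`
  have hV : (((ν * (4 * Real.pi ^ 2 * freqNormSq k)) : ℝ) : ℂ) • mFourierCoeff w k +
      ((WithLp.toLp 2 (fun pp : Fin 3 => transportSym (fun jj mm => mFourierCoeff (complexify ∘ U) mm jj)
            (fun mm => mFourierCoeff w mm pp) k) : EuclideanSpace ℂ (Fin 3)) +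
          (WithLp.toLp 2 (fun pp : Fin 3 => transportSym (fun jj mm => mFourierCoeff w mm jj)
            (fun mm => mFourierCoeff (complexify ∘ U) mm pp) k) : EuclideanSpace ℂ (Fin 3))) +
      (2 * Real.pi * Complex.I * mFourierCoeff q k) • Torus.freqVec k = -mFourierCoeff G k := by
    ext p
    have h := fourier_eq_of_linearizedNSOperator_eq_rhs hU hw hq hE k p
    simp only [PiLp.add_apply, PiLp.smul_apply, PiLp.neg_apply, smul_eq_mul, Torus.freqVec_apply]
    linear_combination -h
  by_cases hk0 : k = 0
  · subst hk0
    rw [Torus.lerayCoeff_zero, Torus.lerayCoeff_zero, add_zero, neg_zero, mFourierCoeff_zero_of_hasZeroMean h0,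
      smul_zero]
  · have e1 := lerayCoeff_of_kdot_eq_zero hk0 (KolmogorovShear.kdot_mFourierCoeff_eq_zero hw hdiv k)
    have h' := congrArg (Torus.lerayCoeff k) hV
    rw [lerayCoeff_add', lerayCoeff_add', lerayCoeff_smul', lerayCoeff_smul', e1, lerayCoeff_freqVec, smul_zero,
      add_zero] at h'
    rw [h', ← neg_one_smul ℂ (mFourierCoeff G k), lerayCoeff_smul', neg_one_smul]

/-- **The classical resolvent relation at `μ = 0` solves the projected lattice equation with right-hand side**:
`Torus.LinNSResolventRel ν U 0 w G` ⇒ `ν4π²|k|² ŵ(k) + Π_k (N(Û,ŵ) + N(ŵ,Û))(k) = −Π_k Ĝ(k)` for every `k`.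
[folklore] -/
theorem latticeEq_of_linNSResolventRel {ν : ℝ} {U : UnitAddTorus (Fin 3) → EuclideanSpace ℝ (Fin 3)} (hU : IsSmooth U)
    {w G : UnitAddTorus (Fin 3) → EuclideanSpace ℂ (Fin 3)} (h : Torus.LinNSResolventRel ν U 0 w G) (k : Fin 3 → ℤ) :
    (((ν * (4 * Real.pi ^ 2 * freqNormSq k)) : ℝ) : ℂ) • mFourierCoeff w k +
      Torus.lerayCoeff k
        ((WithLp.toLp 2 (fun pp : Fin 3 => transportSym (fun jj mm => mFourierCoeff (complexify ∘ U) mm jj)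
            (fun mm => mFourierCoeff w mm pp) k) : EuclideanSpace ℂ (Fin 3)) +
          (WithLp.toLp 2 (fun pp : Fin 3 => transportSym (fun jj mm => mFourierCoeff w mm jj)
            (fun mm => mFourierCoeff (complexify ∘ U) mm pp) k) : EuclideanSpace ℂ (Fin 3))) =
      -Torus.lerayCoeff k (mFourierCoeff G k) := by
  obtain ⟨hw, hdiv, h0, q, hq, hE⟩ := h
  refine leray_linearised_eq_rhs hU hw hdiv h0 hq (fun x => ?_) k
  have h1 := hE x
  rwa [zero_smul, sub_zero] at h1


/-- **Registered sub-goal `lsTransfer_part`**: `latticeEq_of_linNSResolventRel` in Pi-form. [folklore] -/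
theorem lsTransfer_part : ∀ (ν : ℝ) (U : UnitAddTorus (Fin 3) → EuclideanSpace ℝ (Fin 3)) (w G : UnitAddTorus (Fin 3) → EuclideanSpace ℂ (Fin 3)), IsSmooth U → Torus.LinNSResolventRel ν U 0 w G → ∀ k : Fin 3 → ℤ, (((ν * (4 * Real.pi ^ 2 * freqNormSq k)) : ℝ) : ℂ) • mFourierCoeff w k + Torus.lerayCoeff k ((WithLp.toLp 2 (fun pp : Fin 3 => transportSym (fun jj mm => mFourierCoeff (complexify ∘ U) mm jj) (fun mm => mFourierCoeff w mm pp) k) : EuclideanSpace ℂ (Fin 3)) + (WithLp.toLp 2 (fun pp : Fin 3 => transportSym (fun jj mm => mFourierCoeff w mm jj) (fun mm => mFourierCoeff (complexify ∘ U) mm pp) k) : EuclideanSpace ℂ (Fin 3))) = -Torus.lerayCoeff k (mFourierCoeff G k) :=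
  fun _ _ _ _ hU h k => latticeEq_of_linNSResolventRel hU h k

end Summit.AnomalousDissipation.AnomalousDissipation.Theorems.RobustLoudUpgrade.LsTransfer

end
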